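import Mathlib
import Summits.AtomisticToContinuum.FouriersLaw.Theses.JunctionLocality
import Summits.AtomisticToContinuum.FouriersLaw.Theses.BondHeatUncertainty
import Summits.AtomisticToContinuum.FouriersLaw.Theses.PuiseuxTransferLedger
import Literature.MathematicalPhysics.KineticTheory.LangevinChainGibbs
import Literature.MathematicalPhysics.KineticTheory.PhaseSpacePoisson

/-!
# Skeleton line `drude-coboundary-certificates` for crux `NonBallistic` (stmt-AtomisticToContinuum-9127)

Route `JunctionLocality` (crux rank 3; the same decl is `PuiseuxTransferLedger.NonBallistic` rank 3 and
`BondHeatUncertainty.NonBallistic` support — `Iff.rfl`, Disproof v4 `nonBallistic_iff_puiseux/bondHeat`).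
Crux body: under weak-NESS uniqueness, for every steady-state family `μ` of `pinnedChain ω₂ lam β γ`
(all `> 0`), every `T > 0` and response coefficients `D_N = lim_δ totalCurrent(μ_{N,T+δ/2,T-δ/2})/δ`:
`∀ ε > 0 ∀ N₀ ∃ N ≥ N₀, D_N ≤ ε (N - 1)` (the conductance `G_N = D_N/(N-1)` is not bounded away from `0`).

## The line (crux idea `drude-coboundary-certificates`, MERGED per triage r1 with the static bridge of
`static-duality-floor-ceiling`): "Mazur from above, read at finite volume"

Every LOCAL, polynomial, momentum-even observable `w` on `R+1` consecutive sites ("heat gauge potential")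
gives, on the `N`-chain, the bulk fluctuation field
`G_N(w) = ∑_{x=1}^{N-R-2} (j_x − {H_N, τ_x w})` (`bulkField`; bond currents minus Liouvillian
coboundaries of the translates, the window kept one site away from both thermostatted sites) and the
STATIC certificate `𝔖_N(w,T) = ∫ G_N(w)² dμ_{N,T}` (`certificate`; an equilibrium Gibbs variance of a local
polynomial — `N⁻¹𝔖_N(w,T) → 𝔰_T(w) = ∑_{y∈ℤ} Cov_T(ρ_w, τ_y ρ_w)`, the card's `ℋ₀`-seminorm, by 1-D
transfer-operator clustering, but NO infinite-volume object is needed below). Three stubs and the shared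
item (K) compose into the crux BY NAME (`NonBallistic_of`, sorry-free real analysis):

* `stub_bulkStationarity` (FIXED `N`, M–L): for every weak steady state `ν` at `(T_L, T_R)` (under
  uniqueness it is the CEHR invariant measure, `e^{ϑH} ∈ L¹`, in tree): `G_N(w) ∈ L¹(ν)` and
  `∫ G_N(w) dν = ((N-R-2)/(N-1)) · totalCurrent ν` — EXACTLY: (i) `∫ {H_N, τ_x w} dν = ∫ L(τ_x w) dν = 0`
  because the two Ornstein–Uhlenbeck bath terms of `L` do not see an observable free of `p_0, p_{N-1}`
  (weak Fokker–Planck equation extended from `C_c^∞` to polynomial observables by cutoff + moments);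
  (ii) every bond carries the same mean current (`L h_x = j_{x-1} − j_x` at interior sites). This is the
  card's "spatial gradients / coboundaries are free" made finite-`N` and response-free (triage r1-2/3
  sharpen (a) of the static bridge: no response DENSITY is consumed).
* `stub_hellingerResponse` (FIXED `N`, M–L): if `KL(μ_{N,δ} ‖ Θ_*μ_{N,δ}) ≤ K δ²` eventually and
  `∫ G_N(w) dμ_{N,δ} / δ → ℓ`, then `ℓ² ≤ K · 𝔖_N(w,T)`. Content: `G` is `Θ`-odd (`w` is `p`-even, `{H,·}`
  flips parity, `j_x` is odd), so `E_{μ_δ}G = ½(E_{μ_δ}G − E_{Θμ_δ}G) ≤ ‖G‖_{L²(μ_δ)}·√KL` (Cauchy–Schwarz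
  through the Hellinger affinity, `2H² ≤ KL`), plus continuity of the second moments of polynomial
  observables along the NESS family at `δ → 0` (`μ_{N,T,T}` = Gibbs by uniqueness,
  `pinnedChain_isSteadyState_gibbsMeasure`). With (K) (`K = C_K N`) this is the CEILING
  `limsup_N G_N² ≤ C_K·limsup_N N⁻¹𝔖_N(w,T)` for every certificate `w` — Mazur's inequality run from ABOVE.
* `stub_coboundaryCertificates` (the BET, XL, HARDEST; the card's transferred crux `C⁺ = inf_w 𝔰_T(w) = 0`
  in finite-volume form): for all parameters `> 0`, `T > 0`, `ε > 0` there are a range `R` and a gauge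
  potential `w` with `𝔖_N(w,T) ≤ ε·N` for all large `N` — "the bond current is an approximate Liouvillian
  coboundary in the zero-wavenumber seminorm", i.e. ZERO DRUDE WEIGHT of the infinite pinned anharmonic
  chain in its constructive (least-squares over local polynomials) form. FALSE at `lam = β = 0` (the
  harmonic total current is conserved: `𝔖_N ≥ D_harm·N` for every `w`), so this is where anharmonicity is
  used; `T`-dependence of `(R, w)` is allowed (range `≳` mean free path `∝ (lam T)⁻²`).
* (K) `BondHeatUncertainty.ExtensiveSnapshotIrreversibility` (stmt-AtomisticToContinuum-9121, shared open
  item, consumed BY NAME as a hypothesis of `NonBallistic_of`, exactly as the proved glues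
  `transferToNonBallistic_proof` and `Ideator2Sketch.nonBallistic_of_subBallisticTotalCurrent` do).

GLUE (`NonBallistic_of`, proved): fix `ε`, take `ε' = ε²/(16(C_K⁺+1))`, `(R, w, N₁)` from the certificates,
`N = max(N₀, N₁, 2R+4)`; stationarity + the response limit give `ℓ_N = c_N D_N`, `c_N = (N-R-2)/(N-1) ≥ ½`;
Hellinger + (K) give `c_N² D_N² ≤ C_K⁺ N 𝔖_N ≤ C_K⁺ ε' N²`; hence `D_N² ≤ ε²N²/4 ≤ ε²(N-1)²`, `D_N ≤ ε(N-1)`.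

## Disproof used (cdisprove v1–v4; `Disproof.lean` lives only under `run/gate/evidence/`, NOT mounted in this
jail and not published under `Cruxes/` — used through its evidence notes, as all three triagers did)
* `nonBallistic_of_fouriersLaw` (necessity) — consistent: the line proves the necessary rung only.
* `not_nonBallisticFor_harmonic` (LOAD-BEARING anharmonicity) — HONOURED at `stub_coboundaryCertificates`
  and only there: stubs 1–2 hold verbatim for `pinnedChain ω₂ 0 0 γ`; the certificate stub is false there
  (conserved harmonic current `J = ½Q₁`, `{H₂,Q₁} = 0`, triage r1-2 check), so the line cannot prove the
  refuted harmonic instance.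
* `nonBallistic_iff_temperature_one` (scaling conjugacy; "a certificate at one parameter point settles one
  hyperbola") — HONOURED: `stub_coboundaryCertificates` is a `∀ T ∃ (R,w)` THEOREM about a family of
  certificates, not a finite list of numbers; numerical certificates `D_{d,R}` stay the falsifier/diagnostic.
* `not_nonBallisticForAnyT` / corners `D_0 = D_1 = 0` — irrelevant here (`T > 0` fixed; `N ≥ 2R+4`).
* No `_false_without_` theorem names an extra hypothesis `H`; no `Theorems/NonBallistic/Negative/` lemma
  exists (nothing to import); `ledger negatives` (12 entries, 2026-08-16): none concerns Gibbs variances,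
  coboundaries or response bounds — no stub is an instance of a refuted statement.
-/

noncomputable section

open MeasureTheory Filter Topology
open scoped BigOperators

namespace Summit.AtomisticToContinuum.FouriersLaw.Cruxes.NonBallistic.DrudeCoboundaryCertificates

open Literature.MathematicalPhysics.KineticTheory.HeatConduction

/-! ### The objects of the line (finite `N` only; no infinite-volume state, flow or `tsum`) -/

/-- Translate of a local observable `w` on `R+1` consecutive sites to the sites `x, …, x+R` of the
`N`-chain (junk `0` if the window does not fit, which the bulk window below never lets happen). -/
def translate {R : ℕ} (w : PhaseSpace (R + 1) → ℝ) (N x : ℕ) : PhaseSpace N → ℝ :=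
  fun z => if h : x + R < N then
      w (fun k : Fin (R + 1) => z.1 ⟨x + k.val, by have := k.isLt; omega⟩,
         fun k : Fin (R + 1) => z.2 ⟨x + k.val, by have := k.isLt; omega⟩)
    else 0

/-- HEAT GAUGE POTENTIALS of range `R`: POLYNOMIAL observables of the `2(R+1)` window variables that are
EVEN under momentum reversal `p ↦ -p` (so that `j_x − {H, τ_x w}` is odd; the card's parity bookkeeping —
the degree-2 ansatz space is `span{q_x q_y, p_x p_y}`). Polynomials: smooth, all Gibbs moments finite, and
the least-squares programme `D_{d,R}` of the card is literally the infimum of `certificate` over this class. -/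
def IsGaugePotential (R : ℕ) (w : PhaseSpace (R + 1) → ℝ) : Prop :=
  (∃ p : MvPolynomial (Fin (R + 1) ⊕ Fin (R + 1)) ℝ,
      ∀ y : PhaseSpace (R + 1), w y = MvPolynomial.eval (Sum.elim y.1 y.2) p) ∧
    ∀ y : PhaseSpace (R + 1), w (y.1, -y.2) = w y

/-- The residual density at site `x`: `ρ_{w,x} = j_x − {H_N, τ_x w}` (bond current minus the Liouvillian
coboundary of the translated gauge potential; `poisson H f = {H, f}` is the Hamiltonian vector field,
`generator_eq_poisson_of_gamma_eq_zero`). For `1 ≤ x ≤ N-R-2` the bracket only involves sites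
`x-1, …, x+R+1 ⊆ {0, …, N-1}` and coincides with the infinite-chain bracket. -/
def residual (P : OscillatorChain) {R : ℕ} (w : PhaseSpace (R + 1) → ℝ) (N x : ℕ) :
    PhaseSpace N → ℝ :=
  fun z => (if h : x < N then P.bondCurrent N ⟨x, h⟩ z else 0) -
    poisson (P.hamiltonian N) (translate w N x) z

/-- The BULK FLUCTUATION FIELD `G_N(w) = ∑_{x=1}^{N-R-2} ρ_{w,x}` (window `Finset.Ico 1 (N-R-1)`, of
cardinality `N-R-2` once `N ≥ R+3`; it avoids the two thermostatted sites `0` and `N-1`). -/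
def bulkField (P : OscillatorChain) {R : ℕ} (w : PhaseSpace (R + 1) → ℝ) (N : ℕ) :
    PhaseSpace N → ℝ :=
  fun z => ∑ x ∈ Finset.Ico 1 (N - R - 1), residual P w N x z

/-- The STATIC CERTIFICATE `𝔖_N(w,T) = ∫ G_N(w)² dμ_{N,T}` against the Gibbs measure
`OscillatorChain.gibbsMeasure` (= the variance: `G` is odd, the Gibbs state even). A finite-dimensional
Gibbs integral of a polynomial — computable with certified error by the 1-D transfer operator. -/
def certificate (P : OscillatorChain) {R : ℕ} (w : PhaseSpace (R + 1) → ℝ) (N : ℕ) (T : ℝ) : ℝ :=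
  ∫ z, (bulkField P w N z) ^ 2 ∂(P.gibbsMeasure N T)

/-! ### The statements of the line (named `Prop`s over existing declarations) -/

/-- **STUB 1 — Hellinger response bound (fixed `N`).** Under weak-NESS uniqueness, along a steady-state
family `μ`, at `T > 0`: for every gauge potential `w`, every `N`, every `K ≥ 0` with
`KL(μ_{N,T+δ/2,T-δ/2} ‖ Θ_* μ_{N,T+δ/2,T-δ/2}) ≤ K δ²` eventually as `δ → 0` (`δ ≠ 0`), and every limit
`ℓ` of `δ⁻¹ ∫ G_N(w) dμ_{N,T+δ/2,T-δ/2}`: `ℓ² ≤ K · 𝔖_N(w,T)`. (Oddness of `G_N(w)` under `Θ(q,p) = (q,-p)`;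
`|E_μ G − E_{Θμ} G| ≤ 2‖G‖_{L²(μ)} √KL(μ‖Θμ)`; `∫ G² dμ_{N,δ} → ∫ G² dμ_{N,T} = 𝔖_N` as `δ → 0`.) -/
def HellingerResponse : Prop :=
  ∀ ω₂ lam β γ : ℝ, 0 < ω₂ → 0 < lam → 0 < β → 0 < γ →
    (∀ (N : ℕ) (T_L T_R : ℝ), 0 < T_L → 0 < T_R → ∀ μ ν : Measure (PhaseSpace N),
      (pinnedChain ω₂ lam β γ).IsSteadyState N T_L T_R μ →
      (pinnedChain ω₂ lam β γ).IsSteadyState N T_L T_R ν → μ = ν) →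
    ∀ μ : (N : ℕ) → ℝ → ℝ → Measure (PhaseSpace N),
      (∀ (N : ℕ) (T_L T_R : ℝ), 0 < T_L → 0 < T_R →
        (pinnedChain ω₂ lam β γ).IsSteadyState N T_L T_R (μ N T_L T_R)) →
      ∀ T : ℝ, 0 < T →
        ∀ (R : ℕ) (w : PhaseSpace (R + 1) → ℝ), IsGaugePotential R w →
          ∀ (N : ℕ) (K ℓ : ℝ), 0 ≤ K →
            (∀ᶠ δ in 𝓝[≠] (0 : ℝ),
              InformationTheory.klDiv (μ N (T + δ / 2) (T - δ / 2))
                ((μ N (T + δ / 2) (T - δ / 2)).map (fun x : PhaseSpace N => (x.1, -x.2)))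
                ≤ ENNReal.ofReal (K * δ ^ 2)) →
            Tendsto (fun δ : ℝ =>
              (∫ z, bulkField (pinnedChain ω₂ lam β γ) w N z ∂(μ N (T + δ / 2) (T - δ / 2))) / δ)
              (𝓝[≠] 0) (𝓝 ℓ) →
            ℓ ^ 2 ≤ K * certificate (pinnedChain ω₂ lam β γ) w N T

/-- **STUB 2 — Bulk stationarity identity (fixed `N`).** Under weak-NESS uniqueness, for every gauge
potential `w` of range `R`, every `N ≥ R+3`, all `T_L, T_R > 0` and every weak steady state `ν` of the
`N`-chain at `(T_L, T_R)`: `G_N(w) ∈ L¹(ν)` and `∫ G_N(w) dν = ((N-R-2)/(N-1)) · totalCurrent ν`.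
(Coboundaries of bulk observables have zero steady mean — the bath part of the generator does not see
them; all `N-1` bond currents have the same steady mean; `totalCurrent = (N-1)·J̃`.) -/
def BulkStationarity : Prop :=
  ∀ ω₂ lam β γ : ℝ, 0 < ω₂ → 0 < lam → 0 < β → 0 < γ →
    (∀ (N : ℕ) (T_L T_R : ℝ), 0 < T_L → 0 < T_R → ∀ μ ν : Measure (PhaseSpace N),
      (pinnedChain ω₂ lam β γ).IsSteadyState N T_L T_R μ →
      (pinnedChain ω₂ lam β γ).IsSteadyState N T_L T_R ν → μ = ν) →
    ∀ (R : ℕ) (w : PhaseSpace (R + 1) → ℝ), IsGaugePotential R w →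
      ∀ (N : ℕ) (T_L T_R : ℝ), 0 < T_L → 0 < T_R → R + 3 ≤ N →
        ∀ ν : Measure (PhaseSpace N), (pinnedChain ω₂ lam β γ).IsSteadyState N T_L T_R ν →
          Integrable (bulkField (pinnedChain ω₂ lam β γ) w N) ν ∧
          ∫ z, bulkField (pinnedChain ω₂ lam β γ) w N z ∂ν =
            (((N : ℝ) - R - 2) / ((N : ℝ) - 1)) * (pinnedChain ω₂ lam β γ).totalCurrent ν

/-- **STUB 3 — Coboundary certificates (the bet; zero Drude weight in finite-volume certificate form).**
For all `ω₂, lam, β, γ > 0`, `T > 0`, `ε > 0` there are a range `R`, a gauge potential `w` and `N₀` with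
`G_N(w) ∈ L²(μ_{N,T})` and `𝔖_N(w,T) ≤ ε · N` for all `N ≥ N₀`: the bond current is an approximate
Liouvillian coboundary of a LOCAL POLYNOMIAL in the zero-wavenumber seminorm. -/
def CoboundaryCertificates : Prop :=
  ∀ ω₂ lam β γ : ℝ, 0 < ω₂ → 0 < lam → 0 < β → 0 < γ → ∀ T : ℝ, 0 < T →
    ∀ ε : ℝ, 0 < ε →
      ∃ (R : ℕ) (w : PhaseSpace (R + 1) → ℝ), IsGaugePotential R w ∧
        ∃ N₀ : ℕ, ∀ N : ℕ, N₀ ≤ N →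
          MemLp (bulkField (pinnedChain ω₂ lam β γ) w N) 2 ((pinnedChain ω₂ lam β γ).gibbsMeasure N T) ∧
          certificate (pinnedChain ω₂ lam β γ) w N T ≤ ε * (N : ℝ)

/-! ### Registered stubs (the open obligations of the line) -/

/-- STUB 1 (fixed `N`, M–L): Hellinger response bound. -/
theorem stub_hellingerResponse : HellingerResponse := by
  sorry

/-- STUB 2 (fixed `N`, M–L): bulk stationarity identity. -/
theorem stub_bulkStationarity : BulkStationarity := by
  sorry

/-- STUB 3 (XL, HARDEST — the lead's stub): coboundary certificates / zero Drude weight. -/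
theorem stub_coboundaryCertificates : CoboundaryCertificates := by
  sorry

/-! ### Name-keyed aliases of the three statements (the skeleton audit admits a hypothesis of the
composition only if its head constant is a registered obligation or is named like a declared stub) -/
namespace Registered

/-- Alias of `HellingerResponse` keyed by the registered stub name. -/
abbrev stub_hellingerResponse : Prop := HellingerResponse
/-- Alias of `BulkStationarity` keyed by the registered stub name. -/
abbrev stub_bulkStationarity : Prop := BulkStationarity
/-- Alias of `CoboundaryCertificates` keyed by the registered stub name. -/
abbrev stub_coboundaryCertificates : Prop := CoboundaryCertificates

end Registered

/-! ### The composition: the three stubs and the shared item (K) imply the crux, BY NAME (no `sorry`) -/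

/-- **Mazur from above decides the non-ballistic rung.** `HellingerResponse` (stub 1),
`BulkStationarity` (stub 2), `CoboundaryCertificates` (stub 3) and the shared route item (K)
`BondHeatUncertainty.ExtensiveSnapshotIrreversibility` (stmt-AtomisticToContinuum-9121) imply
`JunctionLocality.NonBallistic`. Pure real analysis: `ℓ_N = c_N D_N` with `c_N = (N-R-2)/(N-1) ≥ ½`
(stub 2 + the response limit), `ℓ_N² ≤ C_K⁺ N 𝔖_N(w,T) ≤ C_K⁺ ε' N²` (stub 1 + (K) + stub 3 with
`ε' = ε²/(16(C_K⁺+1))`), hence `D_N² ≤ ε²(N-1)²`. -/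
theorem NonBallistic_of (h1 : Registered.stub_hellingerResponse)
    (h2 : Registered.stub_bulkStationarity) (h3 : Registered.stub_coboundaryCertificates)
    (hK : Summit.AtomisticToContinuum.FouriersLaw.Theses.BondHeatUncertainty.ExtensiveSnapshotIrreversibility) :
    Summit.AtomisticToContinuum.FouriersLaw.Theses.JunctionLocality.NonBallistic := by
  intro ω₂ lam β γ hω hl hβ hγ huniq μ hμ T hT D hD ε hε N₀
  -- (K): the snapshot-irreversibility constant, made non-negative
  obtain ⟨C, hC⟩ := hK ω₂ lam β γ hω hl hβ hγ huniq μ hμ T hT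
  set Cp : ℝ := max C 0 with hCp
  have hCp0 : 0 ≤ Cp := le_max_right _ _
  -- the certificate tolerance
  set ε' : ℝ := ε ^ 2 / (16 * (Cp + 1)) with hε'
  have hε'pos : 0 < ε' := by rw [hε']; positivity
  obtain ⟨R, w, hw, N₁, hN₁⟩ := h3 ω₂ lam β γ hω hl hβ hγ T hT ε' hε'pos
  -- the length at which we certify `D_N ≤ ε (N - 1)`
  set N : ℕ := max (max N₀ N₁) (2 * R + 4) with hNdef
  have hN₀ : N₀ ≤ N := le_trans (le_max_left _ _) (le_max_left _ _)
  have hN₁' : N₁ ≤ N := le_trans (le_max_right _ _) (le_max_left _ _)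
  have hNR : 2 * R + 4 ≤ N := le_max_right _ _
  have hR3 : R + 3 ≤ N := by omega
  have hN2 : 2 ≤ N := by omega
  refine ⟨N, hN₀, ?_⟩
  have hNreal : (2 * R + 4 : ℝ) ≤ (N : ℝ) := by exact_mod_cast hNR
  have hRnn : (0 : ℝ) ≤ (R : ℝ) := by positivity
  have hN2r : (2 : ℝ) ≤ (N : ℝ) := by exact_mod_cast hN2
  have hNm1 : 0 < (N : ℝ) - 1 := by linarith
  -- trivial branch: non-positive response
  by_cases hDle : D N ≤ 0
  · have : 0 ≤ ε * ((N : ℝ) - 1) := by positivity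
    linarith
  push Not at hDle
  -- the bulk fraction `c = (N - R - 2)/(N - 1) ∈ [1/2, 1]`
  set c : ℝ := ((N : ℝ) - R - 2) / ((N : ℝ) - 1) with hc
  have hc_half : 1 / 2 ≤ c := by
    rw [hc, le_div_iff₀ hNm1]; linarith
  have hc_pos : 0 < c := by linarith
  -- stub 2 + the response limit: `δ⁻¹ ∫ G dμ_δ → c · D N`
  have hid : ∀ δ : ℝ, 0 < T + δ / 2 → 0 < T - δ / 2 →
      ∫ z, bulkField (pinnedChain ω₂ lam β γ) w N z ∂(μ N (T + δ / 2) (T - δ / 2)) =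
        c * (pinnedChain ω₂ lam β γ).totalCurrent (μ N (T + δ / 2) (T - δ / 2)) := by
    intro δ ha hb
    exact (h2 ω₂ lam β γ hω hl hβ hγ huniq R w hw N (T + δ / 2) (T - δ / 2) ha hb hR3
      (μ N (T + δ / 2) (T - δ / 2)) (hμ N _ _ ha hb)).2
  have hℓ : Tendsto (fun δ : ℝ =>
      (∫ z, bulkField (pinnedChain ω₂ lam β γ) w N z ∂(μ N (T + δ / 2) (T - δ / 2))) / δ)
      (𝓝[≠] 0) (𝓝 (c * D N)) := by
    refine ((hD N).const_mul c).congr' ?_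
    have h2T : ∀ᶠ δ in 𝓝 (0 : ℝ), δ < 2 * T := eventually_lt_nhds (by linarith)
    have h2T' : ∀ᶠ δ in 𝓝 (0 : ℝ), -(2 * T) < δ := eventually_gt_nhds (by linarith)
    filter_upwards [mem_nhdsWithin_of_mem_nhds h2T, mem_nhdsWithin_of_mem_nhds h2T'] with δ hlt hgt
    have ha : 0 < T + δ / 2 := by linarith
    have hb : 0 < T - δ / 2 := by linarith
    rw [hid δ ha hb, mul_div_assoc]
  -- (K) at this `N`, with the non-negative constant `Cp * N`
  have hKL : ∀ᶠ δ in 𝓝[≠] (0 : ℝ),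
      InformationTheory.klDiv (μ N (T + δ / 2) (T - δ / 2))
        ((μ N (T + δ / 2) (T - δ / 2)).map (fun x : PhaseSpace N => (x.1, -x.2)))
        ≤ ENNReal.ofReal (Cp * (N : ℝ) * δ ^ 2) := by
    filter_upwards [hC N] with δ hδ
    refine le_trans hδ (ENNReal.ofReal_le_ofReal ?_)
    have : C ≤ Cp := le_max_left _ _
    have hδ2 : 0 ≤ (N : ℝ) * δ ^ 2 := by positivity
    nlinarith
  have hKnn : 0 ≤ Cp * (N : ℝ) := by positivity
  -- stub 1: the Hellinger response bound
  have hbound : (c * D N) ^ 2 ≤ Cp * (N : ℝ) * certificate (pinnedChain ω₂ lam β γ) w N T :=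
    h1 ω₂ lam β γ hω hl hβ hγ huniq μ hμ T hT R w hw N (Cp * (N : ℝ)) (c * D N) hKnn hKL hℓ
  -- stub 3: the certificate at this `N`
  have hcert : certificate (pinnedChain ω₂ lam β γ) w N T ≤ ε' * (N : ℝ) := (hN₁ N hN₁').2
  -- real arithmetic
  have hN0 : (0 : ℝ) ≤ (N : ℝ) := by positivity
  have h1' : (c * D N) ^ 2 ≤ Cp * ε' * (N : ℝ) ^ 2 := by
    calc (c * D N) ^ 2 ≤ Cp * (N : ℝ) * certificate (pinnedChain ω₂ lam β γ) w N T := hbound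
      _ ≤ Cp * (N : ℝ) * (ε' * (N : ℝ)) := by gcongr
      _ = Cp * ε' * (N : ℝ) ^ 2 := by ring
  -- `D² / 4 ≤ c² D²`
  have hD2 : (D N) ^ 2 / 4 ≤ (c * D N) ^ 2 := by
    have hc2 : 1 / 4 ≤ c ^ 2 := by nlinarith
    have hDD : 0 ≤ (D N) ^ 2 := sq_nonneg _
    calc (D N) ^ 2 / 4 = (1 / 4) * (D N) ^ 2 := by ring
      _ ≤ c ^ 2 * (D N) ^ 2 := by gcongr
      _ = (c * D N) ^ 2 := by ring
  -- `Cp ε' ≤ ε² / 16`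
  have hCε : Cp * ε' ≤ ε ^ 2 / 16 := by
    rw [hε', mul_div_assoc', div_le_div_iff₀ (by positivity) (by positivity)]
    nlinarith [sq_nonneg ε]
  have h2' : (D N) ^ 2 ≤ ε ^ 2 * (N : ℝ) ^ 2 / 4 := by
    have := mul_le_mul_of_nonneg_right hCε (sq_nonneg (N : ℝ))
    nlinarith
  -- `N² / 4 ≤ (N - 1)²` for `N ≥ 2`
  have h3' : (N : ℝ) ^ 2 / 4 ≤ ((N : ℝ) - 1) ^ 2 := by nlinarith
  have h4' : (D N) ^ 2 ≤ (ε * ((N : ℝ) - 1)) ^ 2 := by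
    have hε2 : 0 ≤ ε ^ 2 := sq_nonneg ε
    calc (D N) ^ 2 ≤ ε ^ 2 * (N : ℝ) ^ 2 / 4 := h2'
      _ = ε ^ 2 * ((N : ℝ) ^ 2 / 4) := by ring
      _ ≤ ε ^ 2 * ((N : ℝ) - 1) ^ 2 := by gcongr
      _ = (ε * ((N : ℝ) - 1)) ^ 2 := by ring
  have hεN : 0 ≤ ε * ((N : ℝ) - 1) := by positivity
  exact (abs_le_of_sq_le_sq' h4' hεN).2

/-- Wiring check: the registered stubs and (K) feed `NonBallistic_of` as stated. -/
example (hK : Summit.AtomisticToContinuum.FouriersLaw.Theses.BondHeatUncertainty.ExtensiveSnapshotIrreversibility) :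
    Summit.AtomisticToContinuum.FouriersLaw.Theses.JunctionLocality.NonBallistic :=
  NonBallistic_of stub_hellingerResponse stub_bulkStationarity stub_coboundaryCertificates hK

/-! ### The same composition under the crux's two other names

stmt-AtomisticToContinuum-9127 is ONE statement wanted by three routes; the gate wrote it as three decls
with token-identical bodies (`JunctionLocality.NonBallistic`, `PuiseuxTransferLedger.NonBallistic`,
`BondHeatUncertainty.NonBallistic`; Disproof v4 `nonBallistic_iff_puiseux` / `nonBallistic_iff_bondHeat`
are `Iff.rfl`). So that the skeleton audit finds a concluding theorem whichever decl it resolves the item to,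
the composition is restated (definitionally, no new mathematics) for the other two names. -/

/-- `NonBallistic_of`, concluding the `PuiseuxTransferLedger` copy of the crux BY NAME. -/
theorem NonBallistic_of_puiseux (h1 : Registered.stub_hellingerResponse)
    (h2 : Registered.stub_bulkStationarity) (h3 : Registered.stub_coboundaryCertificates)
    (hK : Summit.AtomisticToContinuum.FouriersLaw.Theses.BondHeatUncertainty.ExtensiveSnapshotIrreversibility) :
    Summit.AtomisticToContinuum.FouriersLaw.Theses.PuiseuxTransferLedger.NonBallistic :=
  NonBallistic_of h1 h2 h3 hK

/-- `NonBallistic_of`, concluding the `BondHeatUncertainty` copy of the crux BY NAME. -/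
theorem NonBallistic_of_bondHeat (h1 : Registered.stub_hellingerResponse)
    (h2 : Registered.stub_bulkStationarity) (h3 : Registered.stub_coboundaryCertificates)
    (hK : Summit.AtomisticToContinuum.FouriersLaw.Theses.BondHeatUncertainty.ExtensiveSnapshotIrreversibility) :
    Summit.AtomisticToContinuum.FouriersLaw.Theses.BondHeatUncertainty.NonBallistic :=
  NonBallistic_of h1 h2 h3 hK

end Summit.AtomisticToContinuum.FouriersLaw.Cruxes.NonBallistic.DrudeCoboundaryCertificates
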